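import Summits.QuantumFields.BalabanUV.Beta.D1BFx.ColumnGaugeTwoPins
import Summits.QuantumFields.BalabanUV.Beta.D1BFx.CombPairSlotLetters
import Summits.QuantumFields.BalabanUV.Beta.D1BFx.ChartDefectWords
import Summits.QuantumFields.BalabanUV.Beta.CombSecondOrderClassBase
import Summits.QuantumFields.BalabanUV.Beta.SymCorrectorLiteralLoc
import Summits.QuantumFields.BalabanUV.Beta.SymCorrectorResponseNull
import Summits.QuantumFields.BalabanUV.Beta.SymTablesAn1FirstOrder
import Summits.QuantumFields.BalabanUV.Beta.CombChartWardSockets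
import Summits.QuantumFields.BalabanUV.Beta.D1BFx.CombMixedSiteLetter
import Summits.QuantumFields.BalabanUV.Beta.D1BFx.ColumnGaugeCombPartner
import Summits.QuantumFields.BalabanUV.Beta.SymCorrectorW2SiteGauge
import Summits.QuantumFields.BalabanUV.Beta.SymCorrectorMixedSiteNull
import Summits.QuantumFields.BalabanUV.Beta.SymCorrectorFaceGauge
import Summits.QuantumFields.BalabanUV.Beta.SymCorrectorTransport

/-!
# `BalabanUV.Beta.D1BFx.ChartDefectLiteralChartPin` — road «BF-x», binder row D1, PART 24 HEAD (H3-literal, CHART LAYER) at the RECORD (`PART24-HEAD-SPEC-g24.md` v1.1 §3;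
# an2 R-D1-g45-5 «two-pin reading; identities at both pins FIRST»): **THE LITERAL OF RECORD's ONE-LOOP WORD AT ITS OWN PIN IS THE STRAIGHT WORD DISPLACED
# BY NAMED WORDS ONLY** — at the literal's propagator `G′ = GcombSh n 0` (`RelInv G′ (bhK + Dsh) axEc`) BOTH gauge layers of the literal's vertices cancel:
# the CHART layer (`G′ = Ψ̂∘G₀∘Ψ̂ᵀ`, face gauge generator `Λf[G₀]`: leaf-03 g31's TT10 `SymCorrectorFaceGauge` + TT20 `SymCorrectorW2SiteGauge` with the record's
# letters `CombPairSlotLetters` ∕ `CombMixedSiteLetter` + TT18 `SymCorrectorResponseNull` for the response rest) — THIS file: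
# `hessKer G′ (vertexOfK G′ n S⁰) (W2SymOfK G′ n S♭ M⁰ S₂⁰ M₂⁰) = hessKer G′ (vertexOfK G₀ n S⁰) (W2SymOfK G₀ n S♭ M⁰ S₂⁰ M₂⁰ + (WMs + W^{Λ}_f))` — and the COLUMN
# layer (`G₀ = coDressKBmAt ρ_c n K₀`, generator `Λc[K₀]`: `ChartDefectLiteralColumnPin`); the two are composed in `ChartDefectTwoPinsLiteral`.
# The displaced words are NAMED here (written out), not bounded: `WMs` (leaf-03's site-law mixed word at `G₀`, scalar `2` against `H = symHessFFAt ρ_c n`)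
# and `W^{Λ}_f := Wmix(Λf; vertexOfK G₀ n S♭) − Wmix(Λf; vertexOfK G₀ n S⁰)` (the chart layer's Λ-sector word); `loc_chartWords_record`: their sum is `Loc`.

HONEST DEPENDENCY (cell records, verbatim): «continuum YM on T⁴ ⇐ BetaPertH ∧ nine spine estimates (0/9 proved); BetaPertH ⇐ (D1) ∧ (D4) ∧
CAP+tail; G-an2-4 gates asym, D1 and NE2/3/4.»  HONEST FRAMING (cell contract, verbatim): «discharging `BetaPertH` makes Bałaban's UV stability
UNCONDITIONAL — a real constructive-QFT result; it is NOT the continuum limit and NOT the Clay problem.»  THIS MODULE DISCHARGES NO binder of row D1 and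
NO estimate of Bałaban's: [our object] identities between OUR kernels composed BY NAME; the colour data `Complete τ`, `TrOrthonormal τ`, `N ≠ 0` are
HYPOTHESES (displayed); prices NO row; no definition, no `def … : Prop`, nothing cited, 0 sorry.  0∕4 row-D1 binders; (K) NOT closed; (J1) ONE OPEN ROW;
NOT D1, NEVER «G-an2-4 closed», NOT `BetaPertH`, NOT continuum, NOT Clay.

ABSOLUTE RULE (cell charter, verbatim): «No internally-minted statement may enter as a cited fact. Every hypothesis is either kernel-proved in this
package or a verbatim quotation of a PUBLISHED theorem with page reference. The manuscript(s) under audit are NOT citable for their own disputed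
steps — they are the thing under adjudication; programme-internal (2001/route/tribunal) claims are never citable.»

Unit `b2b-balaban-beta-d1-p2` (road owner, gen 24), 2026-08-23; no existing file touched.
-/

noncomputable section

namespace Summit.QuantumFields.BalabanUV.Beta.D1BFx.ChartDefectLiteralChartPin

open Finset
open scoped BigOperators
open Literature.MathematicalPhysics.QuantumFieldTheory
open Literature.MathematicalPhysics.QuantumFieldTheory.LatticeForm (quo)
open Literature.MathematicalPhysics.QuantumFieldTheory.Balaban1983to89
open Literature.MathematicalPhysics.QuantumFieldTheory.Balaban1983to89.Beta
open B12Sec2to5 (l1)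
open ColourTrace (Complete TrOrthonormal)
open WilsonVertex2Sym (wsym22)
open WilsonBiStencil (wilsonW₂)
open StepJetData (wilsonA)
open AveragingHessianKernels (ell)
open ExpKernelCalculus (MKer VertexFamily comp hessKer tadpole)
open OneStepResolventKernel (Fib LocStencil)
open OneStepKernelFamily (colH vertexOfK KInvStep)
open SecondOrderResponse (vertexOfM dM K2OfK mixOfK W2OfK W2SymOfK vertex2OfK LocStencilFM vertexFamily_vertexOfM)
open BalabanCompositeJets (LocStencil₂)
open BalabanStepW2 (M2Of vertexFamily_mono')
open AffineAveraging (Site box toSite)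
open AveragingContours (blk)
open AveragingContoursRooted (ctr ctrOff ctrOff_mem_box)
open Summit.QuantumFields.BalabanUV.Beta.TameKernelCalculus (Spr Loc trK decays_of_le)
open Summit.QuantumFields.BalabanUV.Beta.BorderedHessian (diagK bhK sgnK spr_bhK comp_axEc_diagK_comm)
open Summit.QuantumFields.BalabanUV.Beta.DshAn1 (Dsh spr_Dsh)
open Summit.QuantumFields.BalabanUV.Beta.RelInvNullShift (spr_add)
open Summit.QuantumFields.BalabanUV.Beta.ChartConjugation (conjV)
open Summit.QuantumFields.BalabanUV.Beta.ChartConjugationRelative (RelInv)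
open Summit.QuantumFields.BalabanUV.Beta.AxialDressingRooted (coDressKBmAt axEc spr_axEc)
open Summit.QuantumFields.BalabanUV.Beta.AxialProjectorBlockMean (bmGaugeAt)
open Summit.QuantumFields.BalabanUV.Beta.AveragingWardRootedStencils (legSite)
open Summit.QuantumFields.BalabanUV.Beta.SymAveragingHessianCounts (symVhSAt symHessFFAt vertexFamily_symHessFFAt)
open Summit.QuantumFields.BalabanUV.Beta.SymSecondOrderTablesAn1 (symVh₂SAn1 symTablesAn1S2)
open Summit.QuantumFields.BalabanUV.Beta.CombChartStepJets (GcombSh JsB12CombSh0)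
open Summit.QuantumFields.BalabanUV.Beta.CombChartWardSockets (trK_GcombSh)
open Summit.QuantumFields.BalabanUV.Beta.CompositeCorrectorLocality (blockSitesF)
open Summit.QuantumFields.BalabanUV.Beta.SymCorrectorKernel (psiKS)
open Summit.QuantumFields.BalabanUV.Beta.SymCorrectorFace (faceWt)
open Summit.QuantumFields.BalabanUV.Beta.SymCorrectorFaceGauge (vertexOfK_conj_psiKS_eq_add_faceGauge loc_faceGauge comp_faceGauge_axEc_comm)
open Summit.QuantumFields.BalabanUV.Beta.SymCorrectorW2Gauge (loc_faceGen)
open Summit.QuantumFields.BalabanUV.Beta.SymCorrectorW2SiteGauge (W2SymOfK_conj_psiKS_eq_add_Wmix_Wgg_site)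
open Summit.QuantumFields.BalabanUV.Beta.SymCorrectorMixedSiteNull (locStencilFM_anchor)
open Summit.QuantumFields.BalabanUV.Beta.SymCorrectorResponseNull (loc_dM_K2OfK loc_Rresp tadpole_Rresp_eq_zero)
open Summit.QuantumFields.BalabanUV.Beta.SymCorrectorTransport (GcombSh_zero_eq_conj_psiKS_KInvStep)
open Summit.QuantumFields.BalabanUV.Beta.SymCorrectorLiteralLoc (locStencilFM_literalM₂ loc_mixOfK_of_spr)
open Summit.QuantumFields.BalabanUV.Beta.SpineRooted (T2RecOf_zero_level)
open Summit.QuantumFields.BalabanUV.Beta.SpineRecursiveParity (trK_wilsonA parityOdd_smul)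
open Summit.QuantumFields.BalabanUV.Beta.KernelWardRemainderParity (parityOdd_add)
open Summit.QuantumFields.BalabanUV.Beta.SymTablesAn1FirstOrder (trK_symVhSAt trK_M1Of_symHessFFAt)
open Summit.QuantumFields.BalabanUV.Beta.CombSecondOrderClassBase (locStencil₂_T2RecOf_symTablesAn1)
open Summit.QuantumFields.BalabanUV.Beta.D1BFx.ChartDefectResolvent (spr_G0bm_ctr spr_GcombSh_zero relInv_GcombSh_zero)
open Summit.QuantumFields.BalabanUV.Beta.D1BFx.RawStencilSupportRows (locStencil_JsB12CombSh0_S_zero_of_decays locStencil_pure_zero)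
open Summit.QuantumFields.BalabanUV.Beta.D1BFx.ColumnGaugeCombPartner (divV_S_zero_eq_smul_conjV_leggedBorder)
open Summit.QuantumFields.BalabanUV.Beta.D1BFx.CombPairSlotLetters (hL_record hR_record hT_record)
open Summit.QuantumFields.BalabanUV.Beta.D1BFx.CombMixedSiteLetter (divV_M2Of_record_eq)
open Summit.QuantumFields.BalabanUV.Beta.D1BFx.ColumnGaugeTwoPins (hessKer_GcombSh_cancel)
open Summit.QuantumFields.BalabanUV.Beta.D1BFx.ChartDefectWords (loc_vertexOfK_of_spr loc_vertex2OfK_of_spr)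

variable {n : ℕ} [NeZero n] {N : ℕ} {C : Type*} [Fintype C] [DecidableEq C] {τ : C → Matrix (Fin N) (Fin N) ℂ}

/-- [folklore] **THE DISPLACED WORDS OF THE CHART LAYER ARE LOCALISED**: `WMs[G₀] μ y ν y′ + W^{Λ}_f μ y ν y′` (the site-law mixed word of leaf-03's TT20 and the
Λ-sector word of the face gauge generator, both at the road's kernel `G₀`) is `Loc` — the `X` socket of `ChartDefectLiteralColumnPin.hessKer_GcombSh_columnPin_record`. -/
theorem loc_chartWords_record (hodd : Odd n) (cΛ : ℝ) (μ : Fin 4) (y : Site 4) (ν : Fin 4) (y' : Site 4) :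
    Loc (((mixOfK (coDressKBmAt (ctr 4 n) n (KInvStep (d := 3) n 0)) n (fun κ u ρ w => (if blk n ((n : ℤ) • w + (ctr 4 n)) = blk n u then 2 * faceWt (ctrOff 4 n) n κ u else 0) • (symHessFFAt (ctr 4 n) n) ρ w) μ y ν y'
                + mixOfK (coDressKBmAt (ctr 4 n) n (KInvStep (d := 3) n 0)) n (fun κ u ρ w => (if blk n ((n : ℤ) • w + (ctr 4 n)) = blk n u then 2 * faceWt (ctrOff 4 n) n κ u else 0) • (symHessFFAt (ctr 4 n) n) ρ w) ν y' μ y)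
              - (comp (diagK fun z b => ∑ α : Fin (3 + 1), ∑ x ∈ blockSitesF n (blk n (legSite (ctr 4 n) z b)), colH (coDressKBmAt (ctr 4 n) n (KInvStep (d := 3) n 0)) n μ y α x * (2 * faceWt (ctrOff 4 n) n α x)) (vertexOfM (coDressKBmAt (ctr 4 n) n (KInvStep (d := 3) n 0)) n (symHessFFAt (ctr 4 n) n) ν y')
                + comp (diagK fun z b => ∑ α : Fin (3 + 1), ∑ x ∈ blockSitesF n (blk n (legSite (ctr 4 n) z b)), colH (coDressKBmAt (ctr 4 n) n (KInvStep (d := 3) n 0)) n ν y' α x * (2 * faceWt (ctrOff 4 n) n α x)) (vertexOfM (coDressKBmAt (ctr 4 n) n (KInvStep (d := 3) n 0)) n (symHessFFAt (ctr 4 n) n) μ y)))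
          + ((((comp (diagK fun z b => -(∑ α : Fin (3 + 1), ∑ x ∈ blockSitesF n (blk n (legSite (ctr 4 n) z b)), colH (coDressKBmAt (ctr 4 n) n (KInvStep (d := 3) n 0)) n ν y' α x * (((n : ℝ) ^ 4 / 2) * faceWt (ctrOff 4 n) n α x))) (vertexOfK (coDressKBmAt (ctr 4 n) n (KInvStep (d := 3) n 0)) n (fun κ u => ((n : ℝ) ^ 4) • wilsonA 3 κ u + (-((n : ℝ) ^ 8 / 2)) • symVhSAt (ctr 4 n) 3 n rfl κ u) μ y)
                - comp (vertexOfK (coDressKBmAt (ctr 4 n) n (KInvStep (d := 3) n 0)) n (fun κ u => ((n : ℝ) ^ 4) • wilsonA 3 κ u + (-((n : ℝ) ^ 8 / 2)) • symVhSAt (ctr 4 n) 3 n rfl κ u) μ y) (diagK fun z b => -(∑ α : Fin (3 + 1), ∑ x ∈ blockSitesF n (blk n (legSite (ctr 4 n) z b)), colH (coDressKBmAt (ctr 4 n) n (KInvStep (d := 3) n 0)) n ν y' α x * (((n : ℝ) ^ 4 / 2) * faceWt (ctrOff 4 n) n α x))))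
              + (comp (diagK fun z b => -(∑ α : Fin (3 + 1), ∑ x ∈ blockSitesF n (blk n (legSite (ctr 4 n) z b)), colH (coDressKBmAt (ctr 4 n) n (KInvStep (d := 3) n 0)) n μ y α x * (((n : ℝ) ^ 4 / 2) * faceWt (ctrOff 4 n) n α x))) (vertexOfK (coDressKBmAt (ctr 4 n) n (KInvStep (d := 3) n 0)) n (fun κ u => ((n : ℝ) ^ 4) • wilsonA 3 κ u + (-((n : ℝ) ^ 8 / 2)) • symVhSAt (ctr 4 n) 3 n rfl κ u) ν y')
                - comp (vertexOfK (coDressKBmAt (ctr 4 n) n (KInvStep (d := 3) n 0)) n (fun κ u => ((n : ℝ) ^ 4) • wilsonA 3 κ u + (-((n : ℝ) ^ 8 / 2)) • symVhSAt (ctr 4 n) 3 n rfl κ u) ν y') (diagK fun z b => -(∑ α : Fin (3 + 1), ∑ x ∈ blockSitesF n (blk n (legSite (ctr 4 n) z b)), colH (coDressKBmAt (ctr 4 n) n (KInvStep (d := 3) n 0)) n μ y α x * (((n : ℝ) ^ 4 / 2) * faceWt (ctrOff 4 n) n α x))))))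
            - (((comp (diagK fun z b => -(∑ α : Fin (3 + 1), ∑ x ∈ blockSitesF n (blk n (legSite (ctr 4 n) z b)), colH (coDressKBmAt (ctr 4 n) n (KInvStep (d := 3) n 0)) n ν y' α x * (((n : ℝ) ^ 4 / 2) * faceWt (ctrOff 4 n) n α x))) (vertexOfK (coDressKBmAt (ctr 4 n) n (KInvStep (d := 3) n 0)) n (JsB12CombSh0 hodd N (symTablesAn1S2 3 n cΛ) cΛ (-((n : ℝ) ^ 12 / 4)) 0).S μ y)
                - comp (vertexOfK (coDressKBmAt (ctr 4 n) n (KInvStep (d := 3) n 0)) n (JsB12CombSh0 hodd N (symTablesAn1S2 3 n cΛ) cΛ (-((n : ℝ) ^ 12 / 4)) 0).S μ y) (diagK fun z b => -(∑ α : Fin (3 + 1), ∑ x ∈ blockSitesF n (blk n (legSite (ctr 4 n) z b)), colH (coDressKBmAt (ctr 4 n) n (KInvStep (d := 3) n 0)) n ν y' α x * (((n : ℝ) ^ 4 / 2) * faceWt (ctrOff 4 n) n α x))))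
              + (comp (diagK fun z b => -(∑ α : Fin (3 + 1), ∑ x ∈ blockSitesF n (blk n (legSite (ctr 4 n) z b)), colH (coDressKBmAt (ctr 4 n) n (KInvStep (d := 3) n 0)) n μ y α x * (((n : ℝ) ^ 4 / 2) * faceWt (ctrOff 4 n) n α x))) (vertexOfK (coDressKBmAt (ctr 4 n) n (KInvStep (d := 3) n 0)) n (JsB12CombSh0 hodd N (symTablesAn1S2 3 n cΛ) cΛ (-((n : ℝ) ^ 12 / 4)) 0).S ν y')
                - comp (vertexOfK (coDressKBmAt (ctr 4 n) n (KInvStep (d := 3) n 0)) n (JsB12CombSh0 hodd N (symTablesAn1S2 3 n cΛ) cΛ (-((n : ℝ) ^ 12 / 4)) 0).S ν y') (diagK fun z b => -(∑ α : Fin (3 + 1), ∑ x ∈ blockSitesF n (blk n (legSite (ctr 4 n) z b)), colH (coDressKBmAt (ctr 4 n) n (KInvStep (d := 3) n 0)) n μ y α x * (((n : ℝ) ^ 4 / 2) * faceWt (ctrOff 4 n) n α x)))))))) := by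
  -- abbreviations
  set K₀ : MKer (3 + 1) (Fib 3) := KInvStep (d := 3) n 0 with hK₀def
  set G₀ : MKer (3 + 1) (Fib 3) := coDressKBmAt (ctr 4 n) n K₀ with hG₀def
  set S0 := (JsB12CombSh0 hodd N (symTablesAn1S2 3 n cΛ) cΛ (-((n : ℝ) ^ 12 / 4)) 0).S with hS0def
  set Sfl : Fin (3 + 1) → Site (3 + 1) → MKer (3 + 1) (Fib 3) :=
    fun κ u => ((n : ℝ) ^ 4) • wilsonA 3 κ u + (-((n : ℝ) ^ 8 / 2)) • symVhSAt (ctr 4 n) 3 n rfl κ u with hSfldef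
  have hn1 : 1 ≤ n := Nat.one_le_iff_ne_zero.2 (NeZero.ne n)
  have hn0 : 0 < n := hn1
  have hG₀ : Spr G₀ := spr_G0bm_ctr (d := 3) (Lc := n)
  obtain ⟨CG, δG, hδG, hGd⟩ : Spr G₀ := spr_G0bm_ctr (d := 3) (Lc := n)
  obtain ⟨δK, CK, hδK, hCK, hKd⟩ := OneStepResolventKernel.decays_KInv (N := n) (d := 3)
  obtain ⟨Cs, -, hS⟩ := locStencil_JsB12CombSh0_S_zero_of_decays hodd N (symTablesAn1S2 3 n cΛ) cΛ (-((n : ℝ) ^ 12 / 4)) hKd hCK hδK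
  obtain ⟨Cfl, -, hSfl⟩ := locStencil_pure_zero (n := n) (symTablesAn1S2 3 n cΛ) (δ := 1) zero_le_one
  -- the anchor family is a local field–multiplier family; the multiplier vertex of `H` is localised
  have hHv : VertexFamily (symHessFFAt (ctr 4 n) n) n (2 * (ell (3 + 1) n : ℝ) ^ 2 * Real.exp (4 * ((3 : ℝ) + 1) * n * 1)) 1 :=
    vertexFamily_symHessFFAt (d := 3) hn1 (ctrOff_mem_box hn1) zero_le_one
  have hA := locStencilFM_anchor (d := 3) hn1 hHv zero_le_one (ctr 4 n) (ctrOff 4 n) (2 : ℝ)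
  have hmixA : ∀ μ y ν y', Loc (mixOfK G₀ n (fun κ u ρ w => (if blk n ((n : ℤ) • w + (ctr 4 n)) = blk n u then 2 * faceWt (ctrOff 4 n) n κ u else 0) • (symHessFFAt (ctr 4 n) n) ρ w) μ y ν y') :=
    fun μ y ν y' => loc_mixOfK_of_spr hG₀ hA one_pos μ y ν y'
  have hVM : ∀ ν y', Loc (vertexOfM G₀ n (symHessFFAt (ctr 4 n) n) ν y') := fun ν y' => by
    have hm : 0 < min δG 1 := lt_min hδG one_pos
    have hKm : ExpKernelCalculus.Decays G₀ |CG| (min δG 1) := decays_of_le hGd (min_le_left _ _)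
    have hC1 : 0 ≤ 2 * (ell (3 + 1) n : ℝ) ^ 2 * Real.exp (4 * ((3 : ℝ) + 1) * n * 1) := by positivity
    have hMm := vertexFamily_mono' hHv hC1 (min_le_right δG 1)
    have hV := vertexFamily_vertexOfM (N := n) hKm (abs_nonneg CG) hMm hm le_rfl
    exact ⟨_, _, _, _, half_pos hm, hV ν y'⟩
  have hΘ : ∀ μ y, Loc (diagK fun z b => ∑ α : Fin (3 + 1), ∑ x ∈ blockSitesF n (blk n (legSite (ctr 4 n) z b)), colH G₀ n μ y α x * (2 * faceWt (ctrOff 4 n) n α x)) :=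
    fun μ y => loc_faceGen hn0 hG₀ (ctr 4 n) (ctrOff 4 n) 2 μ y
  have hΛ : ∀ μ y, Loc (diagK fun z b => -(∑ α : Fin (3 + 1), ∑ x ∈ blockSitesF n (blk n (legSite (ctr 4 n) z b)), colH G₀ n μ y α x * (((n : ℝ) ^ 4 / 2) * faceWt (ctrOff 4 n) n α x))) :=
    fun μ y => loc_faceGauge hn0 hGd hδG (ctr 4 n) (ctrOff 4 n) ((n : ℝ) ^ 4 / 2) μ y
  have hV : ∀ μ y, Loc (vertexOfK G₀ n S0 μ y) := fun μ y => loc_vertexOfK_of_spr hG₀ hS (half_pos hδK) μ y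
  have hVfl : ∀ μ y, Loc (vertexOfK G₀ n Sfl μ y) := fun μ y => loc_vertexOfK_of_spr hG₀ hSfl one_pos μ y
  exact (((hmixA μ y ν y').add (hmixA ν y' μ y)).sub (((hΘ μ y).comp (hVM ν y')).add ((hΘ ν y').comp (hVM μ y)))).add
    (((((hΛ ν y').comp (hVfl μ y)).sub ((hVfl μ y).comp (hΛ ν y'))).add
        (((hΛ μ y).comp (hVfl ν y')).sub ((hVfl ν y').comp (hΛ μ y)))).sub
      ((((hΛ ν y').comp (hV μ y)).sub ((hV μ y).comp (hΛ ν y'))).add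
        (((hΛ μ y).comp (hV ν y')).sub ((hV ν y').comp (hΛ μ y)))))

/-- **THE CHART LAYER AT THE LITERAL's PIN CANCELS** [our object] (the (H3-literal) identity, CHART layer, at the literal of record, lockB `cB = −n¹²∕4`): with
`G′ := GcombSh n 0 = Ψ̂∘G₀∘Ψ̂ᵀ` (`SymCorrectorTransport.GcombSh_zero_eq_conj_psiKS_KInvStep`, `Ψ̂ = psiKS (ctrOff 4 n) n`), the record's tables and the FACE gauge generator
`Λf μ y := diagK (z b ↦ −Σ_α Σ_x colH G₀ n μ y α x·((n⁴∕2)·faceWt (ctrOff 4 n) n α x))`,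
`hessKer G′ (vertexOfK G′ n S⁰) (W2SymOfK G′ n S♭ M⁰ S₂⁰ M₂⁰) μ₀ ν₀ z₀ = hessKer G′ (vertexOfK G₀ n S⁰) (μ y ν y′ ↦ W2SymOfK G₀ n S♭ M⁰ S₂⁰ M₂⁰ μ y ν y′ + (WMs μ y ν y′ + W^{Λ}_f μ y ν y′)) μ₀ ν₀ z₀`
— leaf-03 g31's TT10 (first order) and TT20 v1.1 (second order, all four slot letters by `CombPairSlotLetters` ∕ `CombMixedSiteLetter`) at `K := G₀`, TT18's response rest as
`Nr′` (`loc_Rresp`, `tadpole_Rresp_eq_zero`: `trK_GcombSh`, row parities, `relInv_GcombSh_zero`, `comp_axEc_diagK_comm`), then `ColumnGaugeTwoPins.hessKer_GcombSh_cancel`;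
DISPLACED (named, not bounded): the site-law mixed word `WMs μ y ν y′ := (mixOfK G₀ n A μ y ν y′ + mixOfK G₀ n A ν y′ μ y) − (Θ′ μ y∘vertexOfM G₀ n H ν y′ + Θ′ ν y′∘vertexOfM G₀ n H μ y)`
(`H = symHessFFAt ρ_c n`, anchor `A κ u ρ w := [blk n (n•w + ρ_c) = blk n u]·2·faceWt κ u • H ρ w`, `Θ′` the positive generator at scalar `2`) and `W^{Λ}_f := Wmix(Λf; vertexOfK G₀ n S♭) − Wmix(Λf; vertexOfK G₀ n S⁰)`. -/
theorem hessKer_GcombSh_chartPin_record (hodd : Odd n) (hτ : Complete τ) (ho : TrOrthonormal τ) (hN : N ≠ 0) (c : C) (cΛ : ℝ)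
    (μ₀ ν₀ : Fin 4) (z₀ : Site 4) :
    hessKer (GcombSh (d := 3) n 0) (vertexOfK (GcombSh (d := 3) n 0) n (JsB12CombSh0 hodd N (symTablesAn1S2 3 n cΛ) cΛ (-((n : ℝ) ^ 12 / 4)) 0).S)
        (W2SymOfK (GcombSh (d := 3) n 0) n (fun κ u => ((n : ℝ) ^ 4) • wilsonA 3 κ u + (-((n : ℝ) ^ 8 / 2)) • symVhSAt (ctr 4 n) 3 n rfl κ u)
          ((symTablesAn1S2 3 n cΛ).M 0) (fun κ u κ' u' => ((n : ℝ) ^ 8) • wilsonW₂ 3 ((8 * (N : ℝ) ^ 2)⁻¹ • wsym22 N) κ u κ' u' + (-((n : ℝ) ^ 12 / 4)) • symVh₂SAn1 3 n κ u κ' u')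
          (M2Of 3 n (symTablesAn1S2 3 n cΛ).mixFF 0)) μ₀ ν₀ z₀
      = hessKer (GcombSh (d := 3) n 0) (vertexOfK (coDressKBmAt (ctr 4 n) n (KInvStep (d := 3) n 0)) n (JsB12CombSh0 hodd N (symTablesAn1S2 3 n cΛ) cΛ (-((n : ℝ) ^ 12 / 4)) 0).S)
        (fun μ y ν y' =>
          W2SymOfK (coDressKBmAt (ctr 4 n) n (KInvStep (d := 3) n 0)) n (fun κ u => ((n : ℝ) ^ 4) • wilsonA 3 κ u + (-((n : ℝ) ^ 8 / 2)) • symVhSAt (ctr 4 n) 3 n rfl κ u)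
              ((symTablesAn1S2 3 n cΛ).M 0) (fun κ u κ' u' => ((n : ℝ) ^ 8) • wilsonW₂ 3 ((8 * (N : ℝ) ^ 2)⁻¹ • wsym22 N) κ u κ' u' + (-((n : ℝ) ^ 12 / 4)) • symVh₂SAn1 3 n κ u κ' u')
              (M2Of 3 n (symTablesAn1S2 3 n cΛ).mixFF 0) μ y ν y'
          + (((mixOfK (coDressKBmAt (ctr 4 n) n (KInvStep (d := 3) n 0)) n (fun κ u ρ w => (if blk n ((n : ℤ) • w + (ctr 4 n)) = blk n u then 2 * faceWt (ctrOff 4 n) n κ u else 0) • (symHessFFAt (ctr 4 n) n) ρ w) μ y ν y'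
                + mixOfK (coDressKBmAt (ctr 4 n) n (KInvStep (d := 3) n 0)) n (fun κ u ρ w => (if blk n ((n : ℤ) • w + (ctr 4 n)) = blk n u then 2 * faceWt (ctrOff 4 n) n κ u else 0) • (symHessFFAt (ctr 4 n) n) ρ w) ν y' μ y)
              - (comp (diagK fun z b => ∑ α : Fin (3 + 1), ∑ x ∈ blockSitesF n (blk n (legSite (ctr 4 n) z b)), colH (coDressKBmAt (ctr 4 n) n (KInvStep (d := 3) n 0)) n μ y α x * (2 * faceWt (ctrOff 4 n) n α x)) (vertexOfM (coDressKBmAt (ctr 4 n) n (KInvStep (d := 3) n 0)) n (symHessFFAt (ctr 4 n) n) ν y')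
                + comp (diagK fun z b => ∑ α : Fin (3 + 1), ∑ x ∈ blockSitesF n (blk n (legSite (ctr 4 n) z b)), colH (coDressKBmAt (ctr 4 n) n (KInvStep (d := 3) n 0)) n ν y' α x * (2 * faceWt (ctrOff 4 n) n α x)) (vertexOfM (coDressKBmAt (ctr 4 n) n (KInvStep (d := 3) n 0)) n (symHessFFAt (ctr 4 n) n) μ y)))
          + ((((comp (diagK fun z b => -(∑ α : Fin (3 + 1), ∑ x ∈ blockSitesF n (blk n (legSite (ctr 4 n) z b)), colH (coDressKBmAt (ctr 4 n) n (KInvStep (d := 3) n 0)) n ν y' α x * (((n : ℝ) ^ 4 / 2) * faceWt (ctrOff 4 n) n α x))) (vertexOfK (coDressKBmAt (ctr 4 n) n (KInvStep (d := 3) n 0)) n (fun κ u => ((n : ℝ) ^ 4) • wilsonA 3 κ u + (-((n : ℝ) ^ 8 / 2)) • symVhSAt (ctr 4 n) 3 n rfl κ u) μ y)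
                - comp (vertexOfK (coDressKBmAt (ctr 4 n) n (KInvStep (d := 3) n 0)) n (fun κ u => ((n : ℝ) ^ 4) • wilsonA 3 κ u + (-((n : ℝ) ^ 8 / 2)) • symVhSAt (ctr 4 n) 3 n rfl κ u) μ y) (diagK fun z b => -(∑ α : Fin (3 + 1), ∑ x ∈ blockSitesF n (blk n (legSite (ctr 4 n) z b)), colH (coDressKBmAt (ctr 4 n) n (KInvStep (d := 3) n 0)) n ν y' α x * (((n : ℝ) ^ 4 / 2) * faceWt (ctrOff 4 n) n α x))))
              + (comp (diagK fun z b => -(∑ α : Fin (3 + 1), ∑ x ∈ blockSitesF n (blk n (legSite (ctr 4 n) z b)), colH (coDressKBmAt (ctr 4 n) n (KInvStep (d := 3) n 0)) n μ y α x * (((n : ℝ) ^ 4 / 2) * faceWt (ctrOff 4 n) n α x))) (vertexOfK (coDressKBmAt (ctr 4 n) n (KInvStep (d := 3) n 0)) n (fun κ u => ((n : ℝ) ^ 4) • wilsonA 3 κ u + (-((n : ℝ) ^ 8 / 2)) • symVhSAt (ctr 4 n) 3 n rfl κ u) ν y')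
                - comp (vertexOfK (coDressKBmAt (ctr 4 n) n (KInvStep (d := 3) n 0)) n (fun κ u => ((n : ℝ) ^ 4) • wilsonA 3 κ u + (-((n : ℝ) ^ 8 / 2)) • symVhSAt (ctr 4 n) 3 n rfl κ u) ν y') (diagK fun z b => -(∑ α : Fin (3 + 1), ∑ x ∈ blockSitesF n (blk n (legSite (ctr 4 n) z b)), colH (coDressKBmAt (ctr 4 n) n (KInvStep (d := 3) n 0)) n μ y α x * (((n : ℝ) ^ 4 / 2) * faceWt (ctrOff 4 n) n α x))))))
            - (((comp (diagK fun z b => -(∑ α : Fin (3 + 1), ∑ x ∈ blockSitesF n (blk n (legSite (ctr 4 n) z b)), colH (coDressKBmAt (ctr 4 n) n (KInvStep (d := 3) n 0)) n ν y' α x * (((n : ℝ) ^ 4 / 2) * faceWt (ctrOff 4 n) n α x))) (vertexOfK (coDressKBmAt (ctr 4 n) n (KInvStep (d := 3) n 0)) n (JsB12CombSh0 hodd N (symTablesAn1S2 3 n cΛ) cΛ (-((n : ℝ) ^ 12 / 4)) 0).S μ y)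
                - comp (vertexOfK (coDressKBmAt (ctr 4 n) n (KInvStep (d := 3) n 0)) n (JsB12CombSh0 hodd N (symTablesAn1S2 3 n cΛ) cΛ (-((n : ℝ) ^ 12 / 4)) 0).S μ y) (diagK fun z b => -(∑ α : Fin (3 + 1), ∑ x ∈ blockSitesF n (blk n (legSite (ctr 4 n) z b)), colH (coDressKBmAt (ctr 4 n) n (KInvStep (d := 3) n 0)) n ν y' α x * (((n : ℝ) ^ 4 / 2) * faceWt (ctrOff 4 n) n α x))))
              + (comp (diagK fun z b => -(∑ α : Fin (3 + 1), ∑ x ∈ blockSitesF n (blk n (legSite (ctr 4 n) z b)), colH (coDressKBmAt (ctr 4 n) n (KInvStep (d := 3) n 0)) n μ y α x * (((n : ℝ) ^ 4 / 2) * faceWt (ctrOff 4 n) n α x))) (vertexOfK (coDressKBmAt (ctr 4 n) n (KInvStep (d := 3) n 0)) n (JsB12CombSh0 hodd N (symTablesAn1S2 3 n cΛ) cΛ (-((n : ℝ) ^ 12 / 4)) 0).S ν y')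
                - comp (vertexOfK (coDressKBmAt (ctr 4 n) n (KInvStep (d := 3) n 0)) n (JsB12CombSh0 hodd N (symTablesAn1S2 3 n cΛ) cΛ (-((n : ℝ) ^ 12 / 4)) 0).S ν y') (diagK fun z b => -(∑ α : Fin (3 + 1), ∑ x ∈ blockSitesF n (blk n (legSite (ctr 4 n) z b)), colH (coDressKBmAt (ctr 4 n) n (KInvStep (d := 3) n 0)) n μ y α x * (((n : ℝ) ^ 4 / 2) * faceWt (ctrOff 4 n) n α x))))))))) μ₀ ν₀ z₀ := by
  -- abbreviations
  set K₀ : MKer (3 + 1) (Fib 3) := KInvStep (d := 3) n 0 with hK₀def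
  set G₀ : MKer (3 + 1) (Fib 3) := coDressKBmAt (ctr 4 n) n K₀ with hG₀def
  set S0 := (JsB12CombSh0 hodd N (symTablesAn1S2 3 n cΛ) cΛ (-((n : ℝ) ^ 12 / 4)) 0).S with hS0def
  set Sfl : Fin (3 + 1) → Site (3 + 1) → MKer (3 + 1) (Fib 3) :=
    fun κ u => ((n : ℝ) ^ 4) • wilsonA 3 κ u + (-((n : ℝ) ^ 8 / 2)) • symVhSAt (ctr 4 n) 3 n rfl κ u with hSfldef
  set M0 := (symTablesAn1S2 3 n cΛ).M 0 with hM0def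
  set S₂ : Fin (3 + 1) → Site (3 + 1) → Fin (3 + 1) → Site (3 + 1) → MKer (3 + 1) (Fib 3) :=
    fun κ u κ' u' => ((n : ℝ) ^ 8) • wilsonW₂ 3 ((8 * (N : ℝ) ^ 2)⁻¹ • wsym22 N) κ u κ' u' + (-((n : ℝ) ^ 12 / 4)) • symVh₂SAn1 3 n κ u κ' u' with hS₂def
  set M₂ := M2Of 3 n (symTablesAn1S2 3 n cΛ).mixFF 0 with hM₂def
  have hn1 : 1 ≤ n := Nat.one_le_iff_ne_zero.2 (NeZero.ne n)
  have hn0 : 0 < n := hn1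
  have hr : ctrOff 4 n ∈ box (3 + 1) n := ctrOff_mem_box hn1
  -- structural facts about the kernels and the record's tables
  have hG₀ : Spr G₀ := spr_G0bm_ctr (d := 3) (Lc := n)
  have hG' : Spr (GcombSh (d := 3) n 0) := spr_GcombSh_zero (d := 3) (Lc := n)
  obtain ⟨CG, δG, hδG, hGd⟩ : Spr G₀ := spr_G0bm_ctr (d := 3) (Lc := n)
  obtain ⟨δK, CK, hδK, hCK, hKd⟩ := OneStepResolventKernel.decays_KInv (N := n) (d := 3)
  obtain ⟨Cs, -, hS⟩ := locStencil_JsB12CombSh0_S_zero_of_decays hodd N (symTablesAn1S2 3 n cΛ) cΛ (-((n : ℝ) ^ 12 / 4)) hKd hCK hδK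
  obtain ⟨Cfl, -, hSfl⟩ := locStencil_pure_zero (n := n) (symTablesAn1S2 3 n cΛ) (δ := 1) zero_le_one
  obtain ⟨CM, δM, hδM, hM0⟩ := (symTablesAn1S2 3 n cΛ).hM 0
  obtain ⟨C₂, δ₂, hδ₂, hS₂⟩ := locStencil₂_T2RecOf_symTablesAn1 (Lc := n) N cΛ 0
  rw [T2RecOf_zero_level] at hS₂
  have hC₂ : 0 ≤ C₂ := hS₂.nonneg
  obtain ⟨CF, δF, hδF, hM₂⟩ := locStencilFM_literalM₂ n (symTablesAn1S2 3 n cΛ)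
  have hMs : Spr (bhK n + Dsh n : MKer (3 + 1) (Fib 3)) := spr_add (spr_bhK hn1) (spr_Dsh hn1)
  have hHb : ∀ ρ w p q a e, |symHessFFAt (ctr 4 n) n ρ w p q a e| ≤ 2 * (ell (3 + 1) n : ℝ) ^ 2 * Real.exp (4 * ((3 : ℝ) + 1) * n * 0) :=
    fun ρ w p q a e => by
      have h := vertexFamily_symHessFFAt (d := 3) hn1 (ctrOff_mem_box hn1) le_rfl ρ w p q a e
      rwa [neg_zero, zero_mul, Real.exp_zero, mul_one] at h
  -- the chart transport `G′ = Ψ̂∘G₀∘Ψ̂ᵀ`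
  have eK : (GcombSh (d := 3) n 0) = comp (comp (psiKS (ctrOff 4 n) n) G₀) (trK (psiKS (ctrOff 4 n) n)) :=
    GcombSh_zero_eq_conj_psiKS_KInvStep (d := 3) n
  -- the three structural inputs of the response rest's nullity, at `G′`
  have hKt : trK (comp (comp (psiKS (ctrOff 4 n) n) G₀) (trK (psiKS (ctrOff 4 n) n)))
      = sgnK (comp (comp (psiKS (ctrOff 4 n) n) G₀) (trK (psiKS (ctrOff 4 n) n))) := by
    rw [← eK]; exact trK_GcombSh (d := 3) (Lc := n) 0
  have hRI : RelInv (comp (comp (psiKS (ctrOff 4 n) n) G₀) (trK (psiKS (ctrOff 4 n) n))) (bhK n + Dsh n) (axEc (ctr (3 + 1) n) n) := by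
    rw [← eK]; have h := relInv_GcombSh_zero (d := 3) (Lc := n); rwa [one_smul] at h
  have hSrow : ∀ κ u, trK (Sfl κ u) = -sgnK (Sfl κ u) := fun κ u =>
    parityOdd_add (parityOdd_smul _ (trK_wilsonA (d := 3) κ u)) (parityOdd_smul _ (trK_symVhSAt (ctr 4 n) n κ u))
  have hMrow : ∀ ρ w, trK (M0 ρ w) = -sgnK (M0 ρ w) := fun ρ w => trK_M1Of_symHessFFAt (ctr (3 + 1) n) cΛ 0 ρ w
  -- FIRST ORDER (TT10 at `K := G₀`): `vertexOfK G′ S⁰ = vertexOfK G₀ S⁰ + [Λf, bhK + Dsh]`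
  have eV : vertexOfK (GcombSh (d := 3) n 0) n S0 = fun μ y => vertexOfK G₀ n S0 μ y
      + (comp (diagK fun z b => -(∑ α : Fin (3 + 1), ∑ x ∈ blockSitesF n (blk n (legSite (ctr 4 n) z b)), colH G₀ n μ y α x * (((n : ℝ) ^ 4 / 2) * faceWt (ctrOff 4 n) n α x))) (bhK n + Dsh n)
        - comp (bhK n + Dsh n) (diagK fun z b => -(∑ α : Fin (3 + 1), ∑ x ∈ blockSitesF n (blk n (legSite (ctr 4 n) z b)), colH G₀ n μ y α x * (((n : ℝ) ^ 4 / 2) * faceWt (ctrOff 4 n) n α x)))) := by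
    rw [eK]; funext μ y
    exact vertexOfK_conj_psiKS_eq_add_faceGauge hn0 (fun u => divV_S_zero_eq_smul_conjV_leggedBorder hodd N cΛ (-((n : ℝ) ^ 12 / 4)) u) hr
      hG₀ hS (half_pos hδK) μ y
  -- SECOND ORDER (TT20 v1.1 at `K := G₀`, the four letters of record by name)
  have hb := fun μ y ν y' => W2SymOfK_conj_psiKS_eq_add_Wmix_Wgg_site (d := 3) hn0 hr (K := G₀) hG₀ (S := Sfl) hSfl one_pos (M := M0) hM0 hδM
      (S₂ := S₂) hS₂ hδ₂ (M₂ := M₂) hM₂ hδF (𝕄 := bhK n + Dsh n) hMs (Mt := symHessFFAt (ctr 4 n) n) hHb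
      (ϱ := ctr 4 n) (ξ := (n : ℝ) ^ 4 / 2) (ξ' := (2 : ℝ))
      (fun u => hT_record hodd N cΛ (-((n : ℝ) ^ 12 / 4)) u) (fun κ' u' u => hL_record (n := n) hτ ho hN c κ' u' u)
      (fun α x u' => hR_record (n := n) hτ ho hN c α x u') (fun ρ w u' => divV_M2Of_record_eq cΛ ρ w u') μ y ν y'
  have eW : W2SymOfK (GcombSh (d := 3) n 0) n Sfl M0 S₂ M₂ = fun μ y ν y' =>
      (W2SymOfK G₀ n Sfl M0 S₂ M₂ μ y ν y'
        + (((mixOfK G₀ n (fun κ u ρ w => (if blk n ((n : ℤ) • w + (ctr 4 n)) = blk n u then 2 * faceWt (ctrOff 4 n) n κ u else 0) • (symHessFFAt (ctr 4 n) n) ρ w) μ y ν y'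
                + mixOfK G₀ n (fun κ u ρ w => (if blk n ((n : ℤ) • w + (ctr 4 n)) = blk n u then 2 * faceWt (ctrOff 4 n) n κ u else 0) • (symHessFFAt (ctr 4 n) n) ρ w) ν y' μ y)
              - (comp (diagK fun z b => ∑ α : Fin (3 + 1), ∑ x ∈ blockSitesF n (blk n (legSite (ctr 4 n) z b)), colH G₀ n μ y α x * (2 * faceWt (ctrOff 4 n) n α x)) (vertexOfM G₀ n (symHessFFAt (ctr 4 n) n) ν y')
                + comp (diagK fun z b => ∑ α : Fin (3 + 1), ∑ x ∈ blockSitesF n (blk n (legSite (ctr 4 n) z b)), colH G₀ n ν y' α x * (2 * faceWt (ctrOff 4 n) n α x)) (vertexOfM G₀ n (symHessFFAt (ctr 4 n) n) μ y)))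
          + ((((comp (diagK fun z b => -(∑ α : Fin (3 + 1), ∑ x ∈ blockSitesF n (blk n (legSite (ctr 4 n) z b)), colH G₀ n ν y' α x * (((n : ℝ) ^ 4 / 2) * faceWt (ctrOff 4 n) n α x))) (vertexOfK G₀ n Sfl μ y)
                - comp (vertexOfK G₀ n Sfl μ y) (diagK fun z b => -(∑ α : Fin (3 + 1), ∑ x ∈ blockSitesF n (blk n (legSite (ctr 4 n) z b)), colH G₀ n ν y' α x * (((n : ℝ) ^ 4 / 2) * faceWt (ctrOff 4 n) n α x))))
              + (comp (diagK fun z b => -(∑ α : Fin (3 + 1), ∑ x ∈ blockSitesF n (blk n (legSite (ctr 4 n) z b)), colH G₀ n μ y α x * (((n : ℝ) ^ 4 / 2) * faceWt (ctrOff 4 n) n α x))) (vertexOfK G₀ n Sfl ν y')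
                - comp (vertexOfK G₀ n Sfl ν y') (diagK fun z b => -(∑ α : Fin (3 + 1), ∑ x ∈ blockSitesF n (blk n (legSite (ctr 4 n) z b)), colH G₀ n μ y α x * (((n : ℝ) ^ 4 / 2) * faceWt (ctrOff 4 n) n α x))))))
            - (((comp (diagK fun z b => -(∑ α : Fin (3 + 1), ∑ x ∈ blockSitesF n (blk n (legSite (ctr 4 n) z b)), colH G₀ n ν y' α x * (((n : ℝ) ^ 4 / 2) * faceWt (ctrOff 4 n) n α x))) (vertexOfK G₀ n S0 μ y)
                - comp (vertexOfK G₀ n S0 μ y) (diagK fun z b => -(∑ α : Fin (3 + 1), ∑ x ∈ blockSitesF n (blk n (legSite (ctr 4 n) z b)), colH G₀ n ν y' α x * (((n : ℝ) ^ 4 / 2) * faceWt (ctrOff 4 n) n α x))))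
              + (comp (diagK fun z b => -(∑ α : Fin (3 + 1), ∑ x ∈ blockSitesF n (blk n (legSite (ctr 4 n) z b)), colH G₀ n μ y α x * (((n : ℝ) ^ 4 / 2) * faceWt (ctrOff 4 n) n α x))) (vertexOfK G₀ n S0 ν y')
                - comp (vertexOfK G₀ n S0 ν y') (diagK fun z b => -(∑ α : Fin (3 + 1), ∑ x ∈ blockSitesF n (blk n (legSite (ctr 4 n) z b)), colH G₀ n μ y α x * (((n : ℝ) ^ 4 / 2) * faceWt (ctrOff 4 n) n α x)))))))))
      + (((((comp (diagK fun z b => -(∑ α : Fin (3 + 1), ∑ x ∈ blockSitesF n (blk n (legSite (ctr 4 n) z b)), colH G₀ n ν y' α x * (((n : ℝ) ^ 4 / 2) * faceWt (ctrOff 4 n) n α x))) (vertexOfK G₀ n S0 μ y)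
                - comp (vertexOfK G₀ n S0 μ y) (diagK fun z b => -(∑ α : Fin (3 + 1), ∑ x ∈ blockSitesF n (blk n (legSite (ctr 4 n) z b)), colH G₀ n ν y' α x * (((n : ℝ) ^ 4 / 2) * faceWt (ctrOff 4 n) n α x))))
              + (comp (diagK fun z b => -(∑ α : Fin (3 + 1), ∑ x ∈ blockSitesF n (blk n (legSite (ctr 4 n) z b)), colH G₀ n μ y α x * (((n : ℝ) ^ 4 / 2) * faceWt (ctrOff 4 n) n α x))) (vertexOfK G₀ n S0 ν y')
                - comp (vertexOfK G₀ n S0 ν y') (diagK fun z b => -(∑ α : Fin (3 + 1), ∑ x ∈ blockSitesF n (blk n (legSite (ctr 4 n) z b)), colH G₀ n μ y α x * (((n : ℝ) ^ 4 / 2) * faceWt (ctrOff 4 n) n α x))))))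
          + (comp (diagK fun z b => -(∑ α : Fin (3 + 1), ∑ x ∈ blockSitesF n (blk n (legSite (ctr 4 n) z b)), colH G₀ n μ y α x * (((n : ℝ) ^ 4 / 2) * faceWt (ctrOff 4 n) n α x)))
                  (comp (diagK fun z b => -(∑ α : Fin (3 + 1), ∑ x ∈ blockSitesF n (blk n (legSite (ctr 4 n) z b)), colH G₀ n ν y' α x * (((n : ℝ) ^ 4 / 2) * faceWt (ctrOff 4 n) n α x))) (bhK n + Dsh n)
                    - comp (bhK n + Dsh n) (diagK fun z b => -(∑ α : Fin (3 + 1), ∑ x ∈ blockSitesF n (blk n (legSite (ctr 4 n) z b)), colH G₀ n ν y' α x * (((n : ℝ) ^ 4 / 2) * faceWt (ctrOff 4 n) n α x))))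
                - comp (comp (diagK fun z b => -(∑ α : Fin (3 + 1), ∑ x ∈ blockSitesF n (blk n (legSite (ctr 4 n) z b)), colH G₀ n ν y' α x * (((n : ℝ) ^ 4 / 2) * faceWt (ctrOff 4 n) n α x))) (bhK n + Dsh n)
                    - comp (bhK n + Dsh n) (diagK fun z b => -(∑ α : Fin (3 + 1), ∑ x ∈ blockSitesF n (blk n (legSite (ctr 4 n) z b)), colH G₀ n ν y' α x * (((n : ℝ) ^ 4 / 2) * faceWt (ctrOff 4 n) n α x))))
                  (diagK fun z b => -(∑ α : Fin (3 + 1), ∑ x ∈ blockSitesF n (blk n (legSite (ctr 4 n) z b)), colH G₀ n μ y α x * (((n : ℝ) ^ 4 / 2) * faceWt (ctrOff 4 n) n α x)))))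
        + ((1 / 2 : ℝ) •
              ((dM (-(comp (comp G₀ (comp (comp (trK (psiKS (ctrOff 4 n) n))
                    (dM G₀ n Sfl M0 ν y' + conjV (bhK n + Dsh n) (diagK fun z' b' => ∑ α' : Fin (3 + 1), ∑ x' ∈ blockSitesF n (blk n (legSite (ctr 4 n) z' b')), colH G₀ n ν y' α' x' * (((n : ℝ) ^ 4 / 2) * faceWt (ctrOff 4 n) n α' x'))))
                    (psiKS (ctrOff 4 n) n))) G₀)) n Sfl M0 μ y
                  - dM (K2OfK G₀ n Sfl M0 ν y') n Sfl M0 μ y)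
                + (dM (-(comp (comp G₀ (comp (comp (trK (psiKS (ctrOff 4 n) n))
                    (dM G₀ n Sfl M0 μ y + conjV (bhK n + Dsh n) (diagK fun z' b' => ∑ α' : Fin (3 + 1), ∑ x' ∈ blockSitesF n (blk n (legSite (ctr 4 n) z' b')), colH G₀ n μ y α' x' * (((n : ℝ) ^ 4 / 2) * faceWt (ctrOff 4 n) n α' x'))))
                    (psiKS (ctrOff 4 n) n))) G₀)) n Sfl M0 ν y'
                  - dM (K2OfK G₀ n Sfl M0 μ y) n Sfl M0 ν y'))
            + (1 / 2 : ℝ) •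
              (conjV (bhK n + Dsh n) (diagK fun z b => ∑ α : Fin (3 + 1), ∑ x ∈ blockSitesF n (blk n (legSite (ctr 4 n) z b)),
                  colH (-(comp (comp G₀ (comp (comp (trK (psiKS (ctrOff 4 n) n))
                    (dM G₀ n Sfl M0 ν y' + conjV (bhK n + Dsh n) (diagK fun z' b' => ∑ α' : Fin (3 + 1), ∑ x' ∈ blockSitesF n (blk n (legSite (ctr 4 n) z' b')), colH G₀ n ν y' α' x' * (((n : ℝ) ^ 4 / 2) * faceWt (ctrOff 4 n) n α' x'))))
                    (psiKS (ctrOff 4 n) n))) G₀)) n μ y α x * (((n : ℝ) ^ 4 / 2) * faceWt (ctrOff 4 n) n α x))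
                + conjV (bhK n + Dsh n) (diagK fun z b => ∑ α : Fin (3 + 1), ∑ x ∈ blockSitesF n (blk n (legSite (ctr 4 n) z b)),
                  colH (-(comp (comp G₀ (comp (comp (trK (psiKS (ctrOff 4 n) n))
                    (dM G₀ n Sfl M0 μ y + conjV (bhK n + Dsh n) (diagK fun z' b' => ∑ α' : Fin (3 + 1), ∑ x' ∈ blockSitesF n (blk n (legSite (ctr 4 n) z' b')), colH G₀ n μ y α' x' * (((n : ℝ) ^ 4 / 2) * faceWt (ctrOff 4 n) n α' x'))))
                    (psiKS (ctrOff 4 n) n))) G₀)) n ν y' α x * (((n : ℝ) ^ 4 / 2) * faceWt (ctrOff 4 n) n α x))))) := by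
    funext μ y ν y'
    rw [eK, hb μ y ν y']
    abel
  -- sockets of the cancellation
  have hV : ∀ μ y, Loc (vertexOfK G₀ n S0 μ y) := fun μ y => loc_vertexOfK_of_spr hG₀ hS (half_pos hδK) μ y
  have hΛ : ∀ μ y, Loc (diagK fun z b => -(∑ α : Fin (3 + 1), ∑ x ∈ blockSitesF n (blk n (legSite (ctr 4 n) z b)), colH G₀ n μ y α x * (((n : ℝ) ^ 4 / 2) * faceWt (ctrOff 4 n) n α x))) :=
    fun μ y => loc_faceGauge hn0 hGd hδG (ctr 4 n) (ctrOff 4 n) ((n : ℝ) ^ 4 / 2) μ y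
  have hΛE : ∀ μ y, comp (diagK fun z b => -(∑ α : Fin (3 + 1), ∑ x ∈ blockSitesF n (blk n (legSite (ctr 4 n) z b)), colH G₀ n μ y α x * (((n : ℝ) ^ 4 / 2) * faceWt (ctrOff 4 n) n α x))) (axEc (ctr (3 + 1) n) n)
      = comp (axEc (ctr (3 + 1) n) n) (diagK fun z b => -(∑ α : Fin (3 + 1), ∑ x ∈ blockSitesF n (blk n (legSite (ctr 4 n) z b)), colH G₀ n μ y α x * (((n : ℝ) ^ 4 / 2) * faceWt (ctrOff 4 n) n α x))) :=
    fun μ y => comp_faceGauge_axEc_comm _ _ _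
  have hW2 : ∀ μ y ν y', Loc (vertex2OfK G₀ n S₂ μ y ν y') := fun μ y ν y' => loc_vertex2OfK_of_spr hG₀ hS₂ hC₂ hδ₂ μ y ν y'
  have hmix : ∀ μ y ν y', Loc (mixOfK G₀ n M₂ μ y ν y') := fun μ y ν y' => loc_mixOfK_of_spr hG₀ hM₂ hδF μ y ν y'
  have hRG : ∀ μ y ν y', Loc (dM (K2OfK G₀ n Sfl M0 ν y') n Sfl M0 μ y) := fun μ y ν y' =>
    loc_dM_K2OfK hn0 hG₀ (S := Sfl) hSfl one_pos (M := M0) hM0 hδM ν y' μ y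
  have hW2G : ∀ μ y ν y', Loc (W2SymOfK G₀ n Sfl M0 S₂ M₂ μ y ν y') := fun μ y ν y' => by
    unfold W2SymOfK
    exact (((((hW2 μ y ν y').add (hmix μ y ν y')).add (hmix ν y' μ y)).add (hRG μ y ν y')).add
      ((((hW2 ν y' μ y).add (hmix ν y' μ y)).add (hmix μ y ν y')).add (hRG ν y' μ y))).smul _
  have hX := loc_chartWords_record (N := N) hodd cΛ
  have hNr : ∀ μ y ν y', Loc ((1 / 2 : ℝ) •
              ((dM (-(comp (comp G₀ (comp (comp (trK (psiKS (ctrOff 4 n) n))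
                    (dM G₀ n Sfl M0 ν y' + conjV (bhK n + Dsh n) (diagK fun z' b' => ∑ α' : Fin (3 + 1), ∑ x' ∈ blockSitesF n (blk n (legSite (ctr 4 n) z' b')), colH G₀ n ν y' α' x' * (((n : ℝ) ^ 4 / 2) * faceWt (ctrOff 4 n) n α' x'))))
                    (psiKS (ctrOff 4 n) n))) G₀)) n Sfl M0 μ y
                  - dM (K2OfK G₀ n Sfl M0 ν y') n Sfl M0 μ y)
                + (dM (-(comp (comp G₀ (comp (comp (trK (psiKS (ctrOff 4 n) n))
                    (dM G₀ n Sfl M0 μ y + conjV (bhK n + Dsh n) (diagK fun z' b' => ∑ α' : Fin (3 + 1), ∑ x' ∈ blockSitesF n (blk n (legSite (ctr 4 n) z' b')), colH G₀ n μ y α' x' * (((n : ℝ) ^ 4 / 2) * faceWt (ctrOff 4 n) n α' x'))))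
                    (psiKS (ctrOff 4 n) n))) G₀)) n Sfl M0 ν y'
                  - dM (K2OfK G₀ n Sfl M0 μ y) n Sfl M0 ν y'))
            + (1 / 2 : ℝ) •
              (conjV (bhK n + Dsh n) (diagK fun z b => ∑ α : Fin (3 + 1), ∑ x ∈ blockSitesF n (blk n (legSite (ctr 4 n) z b)),
                  colH (-(comp (comp G₀ (comp (comp (trK (psiKS (ctrOff 4 n) n))
                    (dM G₀ n Sfl M0 ν y' + conjV (bhK n + Dsh n) (diagK fun z' b' => ∑ α' : Fin (3 + 1), ∑ x' ∈ blockSitesF n (blk n (legSite (ctr 4 n) z' b')), colH G₀ n ν y' α' x' * (((n : ℝ) ^ 4 / 2) * faceWt (ctrOff 4 n) n α' x'))))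
                    (psiKS (ctrOff 4 n) n))) G₀)) n μ y α x * (((n : ℝ) ^ 4 / 2) * faceWt (ctrOff 4 n) n α x))
                + conjV (bhK n + Dsh n) (diagK fun z b => ∑ α : Fin (3 + 1), ∑ x ∈ blockSitesF n (blk n (legSite (ctr 4 n) z b)),
                  colH (-(comp (comp G₀ (comp (comp (trK (psiKS (ctrOff 4 n) n))
                    (dM G₀ n Sfl M0 μ y + conjV (bhK n + Dsh n) (diagK fun z' b' => ∑ α' : Fin (3 + 1), ∑ x' ∈ blockSitesF n (blk n (legSite (ctr 4 n) z' b')), colH G₀ n μ y α' x' * (((n : ℝ) ^ 4 / 2) * faceWt (ctrOff 4 n) n α' x'))))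
                    (psiKS (ctrOff 4 n) n))) G₀)) n ν y' α x * (((n : ℝ) ^ 4 / 2) * faceWt (ctrOff 4 n) n α x)))) :=
    fun μ y ν y' => loc_Rresp (d := 3) hn0 hr (K := G₀) hG₀ (S := Sfl) hSfl one_pos (M := M0) hM0 hδM (𝕄 := bhK n + Dsh n) hMs (ctr 4 n) ((n : ℝ) ^ 4 / 2) μ y ν y'
  have hN0 : ∀ μ y ν y', tadpole (GcombSh (d := 3) n 0) ((1 / 2 : ℝ) •
              ((dM (-(comp (comp G₀ (comp (comp (trK (psiKS (ctrOff 4 n) n))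
                    (dM G₀ n Sfl M0 ν y' + conjV (bhK n + Dsh n) (diagK fun z' b' => ∑ α' : Fin (3 + 1), ∑ x' ∈ blockSitesF n (blk n (legSite (ctr 4 n) z' b')), colH G₀ n ν y' α' x' * (((n : ℝ) ^ 4 / 2) * faceWt (ctrOff 4 n) n α' x'))))
                    (psiKS (ctrOff 4 n) n))) G₀)) n Sfl M0 μ y
                  - dM (K2OfK G₀ n Sfl M0 ν y') n Sfl M0 μ y)
                + (dM (-(comp (comp G₀ (comp (comp (trK (psiKS (ctrOff 4 n) n))
                    (dM G₀ n Sfl M0 μ y + conjV (bhK n + Dsh n) (diagK fun z' b' => ∑ α' : Fin (3 + 1), ∑ x' ∈ blockSitesF n (blk n (legSite (ctr 4 n) z' b')), colH G₀ n μ y α' x' * (((n : ℝ) ^ 4 / 2) * faceWt (ctrOff 4 n) n α' x'))))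
                    (psiKS (ctrOff 4 n) n))) G₀)) n Sfl M0 ν y'
                  - dM (K2OfK G₀ n Sfl M0 μ y) n Sfl M0 ν y'))
            + (1 / 2 : ℝ) •
              (conjV (bhK n + Dsh n) (diagK fun z b => ∑ α : Fin (3 + 1), ∑ x ∈ blockSitesF n (blk n (legSite (ctr 4 n) z b)),
                  colH (-(comp (comp G₀ (comp (comp (trK (psiKS (ctrOff 4 n) n))
                    (dM G₀ n Sfl M0 ν y' + conjV (bhK n + Dsh n) (diagK fun z' b' => ∑ α' : Fin (3 + 1), ∑ x' ∈ blockSitesF n (blk n (legSite (ctr 4 n) z' b')), colH G₀ n ν y' α' x' * (((n : ℝ) ^ 4 / 2) * faceWt (ctrOff 4 n) n α' x'))))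
                    (psiKS (ctrOff 4 n) n))) G₀)) n μ y α x * (((n : ℝ) ^ 4 / 2) * faceWt (ctrOff 4 n) n α x))
                + conjV (bhK n + Dsh n) (diagK fun z b => ∑ α : Fin (3 + 1), ∑ x ∈ blockSitesF n (blk n (legSite (ctr 4 n) z b)),
                  colH (-(comp (comp G₀ (comp (comp (trK (psiKS (ctrOff 4 n) n))
                    (dM G₀ n Sfl M0 μ y + conjV (bhK n + Dsh n) (diagK fun z' b' => ∑ α' : Fin (3 + 1), ∑ x' ∈ blockSitesF n (blk n (legSite (ctr 4 n) z' b')), colH G₀ n μ y α' x' * (((n : ℝ) ^ 4 / 2) * faceWt (ctrOff 4 n) n α' x'))))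
                    (psiKS (ctrOff 4 n) n))) G₀)) n ν y' α x * (((n : ℝ) ^ 4 / 2) * faceWt (ctrOff 4 n) n α x)))) = 0 := fun μ y ν y' => by
    rw [eK]
    exact tadpole_Rresp_eq_zero (d := 3) hn0 hr (K := G₀) hG₀ (S := Sfl) hSfl one_pos (M := M0) hM0 hδM (𝕄 := bhK n + Dsh n) hMs (ctr 4 n) ((n : ℝ) ^ 4 / 2)
      hKt hSrow hMrow
      (spr_axEc _ _) hRI (fun g => comp_axEc_diagK_comm (g := g) _ _) μ y ν y'
  -- the cancellation at the literal's pin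
  rw [eV, eW]
  exact hessKer_GcombSh_cancel (Lc := n) (d := 3) hV hΛ hΛE (fun μ y ν y' => (hW2G μ y ν y').add (hX μ y ν y')) hNr hN0 μ₀ ν₀ z₀

end Summit.QuantumFields.BalabanUV.Beta.D1BFx.ChartDefectLiteralChartPin

end
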